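import Literature.AlgebraicGeometry.ModuliOfAbelianVarieties.SiegelPrincipalLevelSimilitudeTower
import HarnessLib

/-!
# The index set of the Hecke kernel: adelic description `=` matrix description modulo `N′`
# ([Milne2005ShimuraVarieties] §6 Thm. 6.11 p. 75 «`V/Λ ≅ V(𝔸_f)/Λ̂`»; [Deligne1971TravauxShimura] 4.16)

Topic `AlgebraicGeometry/ModuliOfAbelianVarieties`; namespace `Literature.AlgebraicGeometry.ModuliOfAbelianVarieties`.
KERNEL ONLY: theorems; no definition, no named fact, no instance, no `sorry`.

Cell hodgecm-mathlib (D-0151), Hecke-link line, socket (B) (B-plan1 (g14) GO 2026-08-29T22:09:35Z).  The kernel of the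
Hecke isogeny `ψ` on a geometric fibre is the set of level sections `σ′_c(s)` indexed by a subset `K₀ ⊆ (ℤ/N′)^{2g}` that
the line types in TWO currencies: ADELICALLY (★ `hcompat_of_pointwiseHeckeQuotient_of_sectionKernel`, ★
`exists_hom_baseChange_forall_pointwiseHeckeQuotient`, B-p14's marking bridge `map_r_eq_one_iff_of_sectionKernel`)

  `K₀ᵃ = {c | ∃ v ∈ ℚ^{2g}, γ v ∈ Λ_r ∧ r′⁻¹ v̂ ≡ c̃/N′ (mod ẑ^{2g})}`   (`Λ_r = ℚ^{2g} ∩ r ẑ^{2g}`, ★ `AdelicCongr`),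

and by MATRICES MOD `N′` (★ `map_fibreHom_eq_one_iff_twist` / `IsSymplecticLiftable.of_fibreIsogeny_of_dualIsogeny_twist`,
B-p04)

  `K₀ᵐ = {c | (γ̄ · R′) c = 0 in (ℤ/N′)^{2g}}`   (`γ̄ = γ mod N′`, `R′ = r′ mod N′` the residue matrix, ★ `integralAdeleResidue`),

for an INTEGRAL `γ ∈ M_{2g}(ℤ)` and `r, r′ ∈ K_δ(1) = GSp_δ(ẑ)`.  This file proves `K₀ᵃ = K₀ᵐ` — [Milne2005ShimuraVarieties]
§6 p. 75: the torsion of `V/Λ` is read in `V(𝔸_f)/Λ̂ = (ℚ/ℤ)^{2g}`-coordinates, where `r′` acts on `N′`-torsion through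
`r′ mod N′` (★ `adelicCongr_val_div_of_entries_residue`):

* `adelicCongr_inv_one_iff_sub_mem_latticeOfGL_one` — `r′⁻¹ v̂ ≡ c̃/N′ (mod ẑ) ↔ v − (R′c)~/N′ ∈ ℤ^{2g}` (★
  `AdelicCongr.mul_left` by the integral `r′`, `r′⁻¹`; ★ `AdelicCongr.trans`; ★ `adelicCongr_val_div_of_entries_residue`);
* `intCast_mulVec_mem_latticeOfGL_one` — an integral matrix preserves `ℤ^{2g}`; `intCast_mulVec_valDiv_mem_latticeOfGL_one_iff`
  — `γ · x̃/N′ ∈ ℤ^{2g} ↔ γ̄ x = 0`;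
* **`exists_adelicCongr_iff_mulVec_eq_zero`** — `c ∈ K₀ᵃ ↔ (γ̄ R′) c = 0` (`Λ_r = ℤ^{2g}` for `r ∈ K_δ(1)`, ★
  `latticeOfGL_mul_eq_of_mem`).  The residue matrix enters as a binder `R′` with
  `hR′ : R′ i j = integralAdeleResidue N′ (r′ i j)` = the first conjunct of ★ `exists_similitudeTower` at `M = N′` (the
  assembler's `↑gT⁻¹`, B-p04 (g17) 22:09:58Z).

## References
* [Milne2005ShimuraVarieties] J. S. Milne, *Introduction to Shimura varieties* (2005), §4 pp. 48–49 (`gΛ`), §6 Thm. 6.11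
  p. 74 and p. 75.
* [Deligne1971TravauxShimura] P. Deligne, *Travaux de Shimura*, Sém. Bourbaki 389 (1971), Exemple 4.16 p. 150.
* [CasselsFrohlichANT1967] J. W. S. Cassels, A. Fröhlich (eds.), *Algebraic Number Theory* (1967), Ch. II §15 (`ẑ/Nẑ = ℤ/N`).
HC_CM is proved only modulo the 7 printed citations until rung 0 closes; this file discharges none of them.
-/

set_option autoImplicit false

noncomputable section

open Matrix NumberField IsDedekindDomain

namespace Literature.AlgebraicGeometry.ModuliOfAbelianVarieties

open Literature.NumberTheory.Adeles

variable {g : ℕ} {δ : Fin g → ℕ}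

/-- The entries of `r ∈ K_δ(1) = GSp_δ(ẑ)` are integral finite adèles (★ `isIntegral_of_isCongOne_one`).
[cite: Deligne1971TravauxShimura, Exemple 4.16 p. 150] -/
theorem entries_mem_integralAdeles_of_mem_principalLevelSubgroup_one {r : gspFinAdelic δ}
    (hr : r ∈ principalLevelSubgroup δ 1) (i j : Fin g ⊕ Fin g) :
    ((r : GL (Fin g ⊕ Fin g) finAdeleQ) : Matrix (Fin g ⊕ Fin g) (Fin g ⊕ Fin g) finAdeleQ) i j ∈
      FiniteAdeleRing.integralAdeles (𝓞 ℚ) ℚ :=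
  isIntegral_of_isCongOne_one ((mem_principalLevelSubgroup_iff δ).1 hr).1 i j

/-- `b ŵ ≡ b ŵ (mod ẑ^{2g})` (reflexivity of ★ `AdelicCongr` at equal matrices). [cite: Milne2005ShimuraVarieties, §6 Thm. 6.11 p. 74 and p. 75] -/
theorem adelicCongr_refl (b : GL (Fin g ⊕ Fin g) finAdeleQ) (w : Fin g ⊕ Fin g → ℚ) : AdelicCongr b b w w := by
  intro i
  rw [sub_self]
  exact zero_mem _

/-- **`r′⁻¹ v̂ ≡ c̃/N′ (mod ẑ^{2g}) ↔ v − (R′ c)~/N′ ∈ ℤ^{2g}`** for `r′ ∈ K_δ(1)` with residue matrix `R′ = r′ mod N′`: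
multiply by the integral `r′` / `r′⁻¹` (★ `AdelicCongr.mul_left`) and compose (★ `AdelicCongr.trans`) with
`r′ · c̃/N′ ≡ (R′c)~/N′` (★ `adelicCongr_val_div_of_entries_residue`); the fibre of the identity relation is a `ℤ^{2g}`-coset
(★ `AdelicCongr.left_iff`). [cite: Milne2005ShimuraVarieties, §6 Thm. 6.11 p. 74 and p. 75] [cite: Deligne1971TravauxShimura, Exemple 4.16 p. 150] -/
theorem adelicCongr_inv_one_iff_sub_mem_latticeOfGL_one {N' : ℕ} [NeZero N'] {r' : gspFinAdelic δ}
    (hr' : r' ∈ principalLevelSubgroup δ 1) (R' : Matrix (Fin g ⊕ Fin g) (Fin g ⊕ Fin g) (ZMod N'))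
    (hR' : ∀ (i j : Fin g ⊕ Fin g)
      (h : ((r' : GL (Fin g ⊕ Fin g) finAdeleQ) : Matrix (Fin g ⊕ Fin g) (Fin g ⊕ Fin g) finAdeleQ) i j ∈
        FiniteAdeleRing.integralAdeles (𝓞 ℚ) ℚ), R' i j = integralAdeleResidue N' ⟨_, h⟩)
    (c : Fin g ⊕ Fin g → ZMod N') (v : Fin g ⊕ Fin g → ℚ) :
    AdelicCongr ((r'⁻¹ : gspFinAdelic δ) : GL (Fin g ⊕ Fin g) finAdeleQ) 1 v (fun i => ((c i).val : ℚ) / N') ↔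
      v - (fun i => (((R' *ᵥ c) i).val : ℚ) / N') ∈ latticeOfGL (1 : GL (Fin g ⊕ Fin g) finAdeleQ) := by
  have hA : AdelicCongr (r' : GL (Fin g ⊕ Fin g) finAdeleQ) 1 (fun i => ((c i).val : ℚ) / N')
      (fun i => (((R' *ᵥ c) i).val : ℚ) / N') := adelicCongr_val_div_of_entries_residue hr' R' hR' c
  have hint := entries_mem_integralAdeles_of_mem_principalLevelSubgroup_one hr'
  have hint' := entries_mem_integralAdeles_of_mem_principalLevelSubgroup_one (inv_mem hr')
  have hmul : (r' : GL (Fin g ⊕ Fin g) finAdeleQ) * ((r'⁻¹ : gspFinAdelic δ) : GL (Fin g ⊕ Fin g) finAdeleQ) = 1 := by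
    rw [Subgroup.coe_inv, mul_inv_cancel]
  have hmul' : ((r'⁻¹ : gspFinAdelic δ) : GL (Fin g ⊕ Fin g) finAdeleQ) * (r' : GL (Fin g ⊕ Fin g) finAdeleQ) = 1 := by
    rw [Subgroup.coe_inv, inv_mul_cancel]
  have hbase : AdelicCongr (1 : GL (Fin g ⊕ Fin g) finAdeleQ) 1 (fun i => (((R' *ᵥ c) i).val : ℚ) / N')
      (fun i => (((R' *ᵥ c) i).val : ℚ) / N') := adelicCongr_refl 1 _
  constructor
  · intro h
    -- multiply by `r′` on the left and compose with (A)
    have h1 : AdelicCongr (1 : GL (Fin g ⊕ Fin g) finAdeleQ) (r' : GL (Fin g ⊕ Fin g) finAdeleQ) v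
        (fun i => ((c i).val : ℚ) / N') := by
      have h' := AdelicCongr.mul_left (u := (r' : GL (Fin g ⊕ Fin g) finAdeleQ)) hint h
      rwa [hmul, mul_one] at h'
    have h2 := (hbase.left_iff).1 (h1.trans hA)
    rwa [inv_one] at h2
  · intro h
    have h2 : AdelicCongr (1 : GL (Fin g ⊕ Fin g) finAdeleQ) 1 v (fun i => (((R' *ᵥ c) i).val : ℚ) / N') :=
      (hbase.left_iff).2 (by rwa [inv_one])
    have h3 : AdelicCongr (1 : GL (Fin g ⊕ Fin g) finAdeleQ) (r' : GL (Fin g ⊕ Fin g) finAdeleQ) v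
        (fun i => ((c i).val : ℚ) / N') := h2.trans (adelicCongr_comm.1 hA)
    have h4 := AdelicCongr.mul_left (u := ((r'⁻¹ : gspFinAdelic δ) : GL (Fin g ⊕ Fin g) finAdeleQ)) hint' h3
    rwa [mul_one, hmul'] at h4

/-- An integral matrix preserves the standard lattice `ℤ^{2g} = Λ_1` (★ `mem_latticeOfGL_one_iff`). [cite: Milne2005ShimuraVarieties, §4 pp. 48–49] -/
theorem intCast_mulVec_mem_latticeOfGL_one (γm : Matrix (Fin g ⊕ Fin g) (Fin g ⊕ Fin g) ℤ) {q : Fin g ⊕ Fin g → ℚ}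
    (hq : q ∈ latticeOfGL (1 : GL (Fin g ⊕ Fin g) finAdeleQ)) :
    (γm.map (Int.cast : ℤ → ℚ)) *ᵥ q ∈ latticeOfGL (1 : GL (Fin g ⊕ Fin g) finAdeleQ) := by
  rw [mem_latticeOfGL_one_iff] at hq ⊢
  choose z hz using hq
  intro i
  refine ⟨∑ j, γm i j * z j, ?_⟩
  simp only [Matrix.mulVec, dotProduct, Matrix.map_apply, Int.cast_sum, Int.cast_mul, hz]

/-- **`γ · x̃/N′ ∈ ℤ^{2g} ↔ γ̄ x = 0` in `(ℤ/N′)^{2g}`** for an integral matrix `γ` and a label `x ∈ (ℤ/N′)^{2g}` with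
natural lift `x̃` (coordinatewise: `(Σ_j γ_{ij} x̃_j)/N′ ∈ ℤ ↔ N′ ∣ Σ_j γ_{ij} x̃_j`, `ZMod.intCast_zmod_eq_zero_iff_dvd`).
[cite: Milne2005ShimuraVarieties, §6 p. 75] [cite: CasselsFrohlichANT1967, Ch. II §15] -/
theorem intCast_mulVec_valDiv_mem_latticeOfGL_one_iff {N' : ℕ} [NeZero N']
    (γm : Matrix (Fin g ⊕ Fin g) (Fin g ⊕ Fin g) ℤ) (x : Fin g ⊕ Fin g → ZMod N') :
    (γm.map (Int.cast : ℤ → ℚ)) *ᵥ (fun i => ((x i).val : ℚ) / N') ∈ latticeOfGL (1 : GL (Fin g ⊕ Fin g) finAdeleQ) ↔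
      (γm.map (Int.castRingHom (ZMod N'))) *ᵥ x = 0 := by
  have hN : (N' : ℚ) ≠ 0 := by exact_mod_cast NeZero.ne N'
  rw [mem_latticeOfGL_one_iff, funext_iff]
  refine forall_congr' fun i => ?_
  -- the `i`-th coordinate is `S / N′` with `S := Σ_j γ i j · x̃_j ∈ ℤ`
  set S : ℤ := ∑ j, γm i j * ((x j).val : ℤ) with hS
  have hcoord : ((γm.map (Int.cast : ℤ → ℚ)) *ᵥ (fun i => ((x i).val : ℚ) / N')) i = (S : ℚ) / N' := by
    simp only [Matrix.mulVec, dotProduct, Matrix.map_apply, hS, Int.cast_sum, Int.cast_mul, Int.cast_natCast,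
      Finset.sum_div]
    refine Finset.sum_congr rfl fun j _ => ?_
    ring
  have hres : ((γm.map (Int.castRingHom (ZMod N'))) *ᵥ x) i = (S : ZMod N') := by
    simp only [Matrix.mulVec, dotProduct, Matrix.map_apply, hS, Int.cast_sum, Int.cast_mul, Int.cast_natCast,
      ZMod.natCast_zmod_val, Int.coe_castRingHom]
  rw [hcoord, Pi.zero_apply, hres, ZMod.intCast_zmod_eq_zero_iff_dvd]
  constructor
  · rintro ⟨z, hz⟩
    refine Dvd.intro_left z ?_
    have h : (z : ℚ) * N' = S := by rw [hz, div_mul_cancel₀ _ hN]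
    exact_mod_cast h
  · rintro ⟨t, ht⟩
    exact ⟨t, by rw [ht, Int.cast_mul, Int.cast_natCast, mul_div_cancel_left₀ _ hN]⟩

/-- **THE INDEX SET OF THE HECKE KERNEL: adelic description = matrix description** (module docstring).  For
`r, r′ ∈ K_δ(1)`, an integral `γ` (`γq = γm` over `ℚ`), the residue matrix `R′ = r′ mod N′` and `c ∈ (ℤ/N′)^{2g}`:
`(∃ v, γ v ∈ Λ_r ∧ r′⁻¹ v̂ ≡ c̃/N′ (mod ẑ^{2g})) ↔ (γ̄ · R′) c = 0` — the partner `v` is unique modulo `ℤ^{2g} = Λ_r` and may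
be taken `(R′c)~/N′`. [cite: Milne2005ShimuraVarieties, §6 Thm. 6.11 p. 74 and p. 75] [cite: Deligne1971TravauxShimura, Exemple 4.16 p. 150] -/
theorem exists_adelicCongr_iff_mulVec_eq_zero {N' : ℕ} [NeZero N'] (r r' : gspFinAdelic δ)
    (hr : r ∈ principalLevelSubgroup δ 1) (hr' : r' ∈ principalLevelSubgroup δ 1)
    (γq : GL (Fin g ⊕ Fin g) ℚ) (γm : Matrix (Fin g ⊕ Fin g) (Fin g ⊕ Fin g) ℤ)
    (hγ : ((γq : GL (Fin g ⊕ Fin g) ℚ) : Matrix (Fin g ⊕ Fin g) (Fin g ⊕ Fin g) ℚ) = γm.map (Int.cast : ℤ → ℚ))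
    (R' : Matrix (Fin g ⊕ Fin g) (Fin g ⊕ Fin g) (ZMod N'))
    (hR' : ∀ (i j : Fin g ⊕ Fin g)
      (h : ((r' : GL (Fin g ⊕ Fin g) finAdeleQ) : Matrix (Fin g ⊕ Fin g) (Fin g ⊕ Fin g) finAdeleQ) i j ∈
        FiniteAdeleRing.integralAdeles (𝓞 ℚ) ℚ), R' i j = integralAdeleResidue N' ⟨_, h⟩)
    (c : Fin g ⊕ Fin g → ZMod N') :
    (∃ v : Fin g ⊕ Fin g → ℚ,
        ((γq : GL (Fin g ⊕ Fin g) ℚ) : Matrix (Fin g ⊕ Fin g) (Fin g ⊕ Fin g) ℚ) *ᵥ v ∈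
            latticeOfGL (r : GL (Fin g ⊕ Fin g) finAdeleQ) ∧
          AdelicCongr ((r'⁻¹ : gspFinAdelic δ) : GL (Fin g ⊕ Fin g) finAdeleQ) 1 v
            (fun i => ((c i).val : ℚ) / N')) ↔
      (γm.map (Int.castRingHom (ZMod N')) * R') *ᵥ c = 0 := by
  -- `Λ_r = ℤ^{2g}` for the integral representative `r`
  have hΛ : latticeOfGL (r : GL (Fin g ⊕ Fin g) finAdeleQ) = latticeOfGL (1 : GL (Fin g ⊕ Fin g) finAdeleQ) := by
    rw [← one_mul (r : GL (Fin g ⊕ Fin g) finAdeleQ)]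
    exact latticeOfGL_mul_eq_of_mem 1 (coe_mem_units_matrix_integralFiniteAdeles_of_mem_principalLevelSubgroup_one hr)
  rw [← Matrix.mulVec_mulVec, ← intCast_mulVec_valDiv_mem_latticeOfGL_one_iff γm (R' *ᵥ c), hΛ, hγ]
  constructor
  · rintro ⟨v, hv, hc⟩
    have h1 := (adelicCongr_inv_one_iff_sub_mem_latticeOfGL_one hr' R' hR' c v).1 hc
    have e : (γm.map (Int.cast : ℤ → ℚ)) *ᵥ (fun i => (((R' *ᵥ c) i).val : ℚ) / N') =
        (γm.map (Int.cast : ℤ → ℚ)) *ᵥ v -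
          (γm.map (Int.cast : ℤ → ℚ)) *ᵥ (v - fun i => (((R' *ᵥ c) i).val : ℚ) / N') := by
      rw [Matrix.mulVec_sub, sub_sub_cancel]
    rw [e]
    exact sub_mem hv (intCast_mulVec_mem_latticeOfGL_one γm h1)
  · intro h
    refine ⟨fun i => (((R' *ᵥ c) i).val : ℚ) / N', h, ?_⟩
    exact (adelicCongr_inv_one_iff_sub_mem_latticeOfGL_one hr' R' hR' c _).2 (by rw [sub_self]; exact zero_mem _)

end Literature.AlgebraicGeometry.ModuliOfAbelianVarieties

end
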